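import Literature.Geometry.Lorentzian.KerrNullShearFree
import Literature.Geometry.Lorentzian.KerrSchildDivergence

/-!
# Triage r2-1 (gen 2) — second, rational-only witness against the literal `radius_anti_horizon`
(card `three-clocks-pinched-development`, `Cruxes/KerrShieldedSettles/SketchIdeator5.lean` l.57–61)

Independent of `TriageR2K3RadiusAntiHorizonFalse.lean` (co-triager r2-3, equatorial witness with `√5`):
here the witness sits on the ROTATION AXIS, where everything is rational.
`M = 1`, `a = 2` (super-extremal, so `Kerr.rPlus 1 2 = 1 + √(1 − 4) = 1` by the `Real.sqrt` junk value),
`x = (0, 0, 0, 1)` (axis point: `r = |z| = 1 = r₊`, `H = M r³/(r⁴ + a² z²) = 1/5`, `ℓ = (1, 0, 0, 1)`),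
`v = (1, 0, 0, 3/10)`: `g(v,v) = −1 + 9/100 + (2/5)(13/10)² = −117/500 < 0` (future timelike, `v⁰ = 1`),
`dr(v) = (r²·(z v³) + a² z v³)/(r Σ) = (3/10 + 12/10)/5 = 3/10 > 0` — outgoing.  So the lemma as typed
(`… → fderiv ℝ (Kerr.radius a) x v ≤ 0`, no `|a| ≤ M`) is false; the repair is `(ha : |a| ≤ M)`.
-/

noncomputable section

open Literature.Geometry.Lorentzian

namespace TriageR2K1

/-- Verbatim the statement of `Ideator5.radius_anti_horizon` (SketchIdeator5.lean l.57–61). -/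
def RadiusAntiHorizon : Prop :=
  ∀ {M a : ℝ} (_hM : 0 ≤ M) {x : E4}
    (_h : Kerr.radius a x = Kerr.rPlus M a) (_hx0 : 0 < Kerr.radius a x) {v : E4}
    (_hv : Kerr.bilin M a x v v ≤ 0) (_hv0 : 0 < v 0),
    fderiv ℝ (Kerr.radius a) x v ≤ 0

/-- The axis witness point `x = (0, 0, 0, 1)`. -/
def xw : E4 := WithLp.toLp 2 ![0, 0, 0, 1]

/-- The witness vector `v = (1, 0, 0, 3/10)` (future timelike, outgoing along the axis). -/
def vw : E4 := WithLp.toLp 2 ![1, 0, 0, 3 / 10]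

@[simp] theorem xw_zero : xw 0 = 0 := rfl
@[simp] theorem xw_one : xw 1 = 0 := rfl
@[simp] theorem xw_two : xw 2 = 0 := rfl
@[simp] theorem xw_three : xw 3 = 1 := rfl
@[simp] theorem vw_zero : vw 0 = 1 := rfl
@[simp] theorem vw_one : vw 1 = 0 := rfl
@[simp] theorem vw_two : vw 2 = 0 := rfl
@[simp] theorem vw_three : vw 3 = 3 / 10 := rfl

theorem spatialNorm_sq_xw : E4.spatialNorm xw ^ 2 = 1 := by
  rw [E4.spatialNorm_sq, xw_one, xw_two, xw_three]
  norm_num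

/-- `r(x) = 1` at the axis point (positive root of the quartic `r⁴ − (ρ² − a²) r² − a² z² = 1 + 3 − 4 = 0`). -/
theorem radius_xw : Kerr.radius 2 xw = 1 := by
  apply Kerr.radius_eq_of_pos_of_quartic one_pos
  rw [spatialNorm_sq_xw, xw_three]
  norm_num

/-- `r₊(1, 2) = 1` (junk value of the super-extremal "horizon radius"). -/
theorem rPlus_one_two : Kerr.rPlus 1 2 = 1 := by
  unfold Kerr.rPlus
  rw [Real.sqrt_eq_zero'.mpr (by norm_num)]
  norm_num

theorem scalarH_xw : Kerr.scalarH 1 2 xw = 1 / 5 := by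
  unfold Kerr.scalarH
  rw [radius_xw, xw_three]
  norm_num

theorem nullCovector_xw_vw : Kerr.nullCovector 2 xw vw = 13 / 10 := by
  rw [Kerr.nullCovector, E4.covector_apply]
  simp only [Kerr.nullCovectorFun, radius_xw, Fin.sum_univ_four, xw_one, xw_two,
    xw_three, vw_zero, vw_one, vw_two, vw_three, Matrix.cons_val_zero, Matrix.cons_val_one,
    Matrix.cons_val, Fin.isValue]
  norm_num

theorem minkowski_vw : Minkowski.bilin vw vw = -91 / 100 := by
  rw [Minkowski.bilin_apply]
  simp only [Fin.sum_univ_three, Fin.isValue, vw_zero]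
  have e1 : vw (Fin.succ 0) = 0 := rfl
  have e2 : vw (Fin.succ 1) = 0 := rfl
  have e3 : vw (Fin.succ 2) = 3 / 10 := rfl
  rw [e1, e2, e3]
  norm_num

theorem bilin_xw_vw : Kerr.bilin 1 2 xw vw vw = -117 / 500 := by
  rw [Kerr.bilin_apply, minkowski_vw, scalarH_xw, nullCovector_xw_vw]
  norm_num

theorem fderiv_radius_xw_vw : fderiv ℝ (Kerr.radius 2) xw vw = 3 / 10 := by
  have hx0 : 0 < Kerr.radius 2 xw := by rw [radius_xw]; norm_num
  rw [Kerr.fderiv_radius_apply hx0, Kerr.blSigma_spatial_eq, radius_xw, spatialNorm_sq_xw]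
  simp only [xw_one, xw_two, xw_three, vw_one, vw_two, vw_three]
  norm_num

/-- **The literal `radius_anti_horizon` is false** (super-extremal junk instance on the axis). -/
theorem not_radiusAntiHorizon : ¬ RadiusAntiHorizon := by
  intro h
  have hx0 : 0 < Kerr.radius 2 xw := by rw [radius_xw]; norm_num
  have hr : Kerr.radius 2 xw = Kerr.rPlus 1 2 := by rw [radius_xw, rPlus_one_two]
  have hv : Kerr.bilin 1 2 xw vw vw ≤ 0 := by rw [bilin_xw_vw]; norm_num
  have hv0 : 0 < vw 0 := by rw [vw_zero]; norm_num
  have key := h (M := 1) (a := 2) (by norm_num) hr hx0 hv hv0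
  rw [fderiv_radius_xw_vw] at key
  norm_num at key

/-- The REPAIRED statement carries `|a| ≤ M`; the witness is then excluded. -/
example : ¬ (|(2:ℝ)| ≤ 1) := by norm_num

end TriageR2K1

end
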